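import Summits.QuantumFields.YangMills.Theorems.UnitScaleTiltProp7PinnedHodgeSplit
import HarnessLib

/-!
# Route `UnitScaleTilt`, crux K1 «MinimiserStabilityRegPr» (stmt-QuantumFields-19200), line «route-R» (`Lines/birth_routeR.lean` v2 5b75208179c6919a),
# stub P `stub_relPoincareOpt` — linear flat core, step N7-B (Step 2 of the N7 SPEC, CARD-19200-V3-g11 §5): THE HODGE SPLIT OF A MATRIX-VALUED BOND
# FIELD, ENTRY BY ENTRY — `Y = B + ∂φ`, `∂^*B = 0`, Frobenius energy identity, Dirichlet principle for the pinned slice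

Cell `ym3-torus` ∕ fleet seat `ym-ust-19200-p1` (gen 11, route-R lead).  WHY.  The structure side of P-lin-flat (the abstract composite `Q^{(k)}` and its gauge
function `Λ`, N6∕N7-A) lives on `M_N(ℂ)`-valued fields, the engine and N3∕N4∕N5 on real ones.  The bridge is entrywise: the real Coulomb gauge of
`Prop7PinnedHodgeSplit` (p596259) applied to the `2N²` real components `re∕im (Y · a b)` and reassembled into ONE matrix potential `φ`.  This file does the
reassembly once, so that the N7 assembly can call `Prop7PinnedConstraintSplit.exists_constraint_on_hodge_parts_bound` (matrix level) on `B := Y − ∂φ` and the real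
lemmas on the components of the SAME `B`, `φ`.

WHAT IS PROVED (sorry-free, no definition; lattice factor `1`):
* `re_diverg_apply` ∕ `im_diverg_apply`, `re_grad_apply` ∕ `im_grad_apply` (entries and real parts commute with `diverg`, `grad`);
* **`exists_matrixCoulombGauge`** — `∃ φ : T → M_N(ℂ), ∂^*(Y − ∂φ) = 0`;
* **`exists_matrixHodgeSplit_pinned`** — for `∂^*Y` supported on a set `C`: `∃ φ`, (i) `∂^*(Y − ∂φ) = 0`, (ii) `Δφ = ∂^*Y`, (iii) the Frobenius energy identity
  `Σ_b Σ_{a,b′} |Y(b)_{ab′}|² = Σ_b Σ |(Y − ∂φ)(b)_{ab′}|² + Σ_b Σ |(∂φ)(b)_{ab′}|²`, (iv) the entrywise Dirichlet principle: for every real `ψ` agreeing with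
  `re (φ · a b′)` (resp. `im`) on `C`, `Σ_b (re (∂φ)(b)_{ab′})² ≤ Σ_b (∂ψ)(b)²` (resp. `im`).

References: T. Bałaban, CMP 95 (1984) 17–40 [Balaban1984PropagatorsI] ((1.21) p.21); CMP 102 (1985) 277–309 [Balaban1985Variational] (Prop. 7 p.299).
-/

noncomputable section

open scoped BigOperators

namespace Summit.QuantumFields.YangMills.Theorems.Prop7MatrixHodgeSplit

open Literature.MathematicalPhysics.QuantumFieldTheory.Balaban1983to89
open Finset LatticeFieldCalculus
open Summit.QuantumFields.YangMills.Theorems.Prop7PinnedHodgeSplit (exists_coulombGauge laplace_eq_diverg_of_hodge sum_grad_sq_le_of_eq_on_support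
  sum_grad_mul_eq_zero_of_diverg_eq_zero)

variable {P : Params} {j N : ℕ}

/-! ## §1 Entries and real parts commute with the lattice operators -/

/-- `((∂^*Y)(x))_{ab} = (∂^*Y_{ab})(x)` and its real part. [folklore] -/
theorem re_diverg_apply (Y : PBond P j → Matrix (Fin N) (Fin N) ℂ) (x : Site P j) (a b : Fin N) :
    ((diverg 1 Y x) a b).re = diverg 1 (fun e : PBond P j => ((Y e) a b).re) x := by
  simp only [diverg_apply, pdiffAdj, one_smul, Matrix.sum_apply, Matrix.sub_apply, Complex.re_sum, Complex.sub_re, smul_eq_mul, one_mul]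

/-- Imaginary part version of `re_diverg_apply`. [folklore] -/
theorem im_diverg_apply (Y : PBond P j → Matrix (Fin N) (Fin N) ℂ) (x : Site P j) (a b : Fin N) :
    ((diverg 1 Y x) a b).im = diverg 1 (fun e : PBond P j => ((Y e) a b).im) x := by
  simp only [diverg_apply, pdiffAdj, one_smul, Matrix.sum_apply, Matrix.sub_apply, Complex.im_sum, Complex.sub_im, smul_eq_mul, one_mul]

/-- `((∂φ)(b))_{ab} = ∂(φ_{ab})(b)`, real part. [folklore] -/
theorem re_grad_apply (φ : Site P j → Matrix (Fin N) (Fin N) ℂ) (e : PBond P j) (a b : Fin N) :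
    ((grad 1 φ e) a b).re = grad 1 (fun x : Site P j => ((φ x) a b).re) e := by
  simp only [grad, one_smul, Matrix.sub_apply, Complex.sub_re, smul_eq_mul, one_mul]

/-- Imaginary part version of `re_grad_apply`. [folklore] -/
theorem im_grad_apply (φ : Site P j → Matrix (Fin N) (Fin N) ℂ) (e : PBond P j) (a b : Fin N) :
    ((grad 1 φ e) a b).im = grad 1 (fun x : Site P j => ((φ x) a b).im) e := by
  simp only [grad, one_smul, Matrix.sub_apply, Complex.sub_im, smul_eq_mul, one_mul]

/-- `((Δφ)(x))_{ab}`, real part. [folklore] -/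
theorem re_laplace_apply (φ : Site P j → Matrix (Fin N) (Fin N) ℂ) (x : Site P j) (a b : Fin N) :
    ((laplace 1 φ x) a b).re = laplace 1 (fun y : Site P j => ((φ y) a b).re) x := by
  simp only [laplace_apply, pdiffAdj, pdiff, one_smul, Matrix.sum_apply, Matrix.sub_apply, Complex.re_sum, Complex.sub_re]

/-- `((Δφ)(x))_{ab}`, imaginary part. [folklore] -/
theorem im_laplace_apply (φ : Site P j → Matrix (Fin N) (Fin N) ℂ) (x : Site P j) (a b : Fin N) :
    ((laplace 1 φ x) a b).im = laplace 1 (fun y : Site P j => ((φ y) a b).im) x := by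
  simp only [laplace_apply, pdiffAdj, pdiff, one_smul, Matrix.sum_apply, Matrix.sub_apply, Complex.im_sum, Complex.sub_im]

/-! ## §2 The matrix Coulomb gauge, assembled from the real components -/

/-- **MATRIX-VALUED COULOMB GAUGE**: every `M_N(ℂ)`-valued bond field on the torus has a matrix potential `φ` with `∂^*(Y − ∂φ) = 0` (the real Coulomb gauges of
the `2N²` components `re∕im Y_{ab}`, reassembled). [cite: Balaban1984PropagatorsI, (1.21) p.21] -/
theorem exists_matrixCoulombGauge (Y : PBond P j → Matrix (Fin N) (Fin N) ℂ) :
    ∃ φ : Site P j → Matrix (Fin N) (Fin N) ℂ, diverg 1 (fun e : PBond P j => Y e - grad 1 φ e) = 0 := by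
  have h1 : (1 : ℝ) ≠ 0 := one_ne_zero
  have hre := fun a b => exists_coulombGauge (P := P) (j := j) h1 (fun e : PBond P j => ((Y e) a b).re)
  have him := fun a b => exists_coulombGauge (P := P) (j := j) h1 (fun e : PBond P j => ((Y e) a b).im)
  choose lre hlre using hre
  choose lim hlim using him
  refine ⟨fun x => Matrix.of fun a b => ((lre a b x : ℝ) : ℂ) + ((lim a b x : ℝ) : ℂ) * Complex.I, ?_⟩
  funext x
  ext a b
  have hR := congrFun (hlre a b) x
  have hI := congrFun (hlim a b) x
  simp only [Pi.zero_apply] at hR hI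
  rw [Pi.zero_apply, Matrix.zero_apply]
  apply Complex.ext
  · rw [re_diverg_apply, Complex.zero_re, ← hR]
    congr 1
    funext e
    simp only [gaugeShift, Matrix.sub_apply, Complex.sub_re, grad, one_smul, Matrix.of_apply, Complex.add_re, Complex.ofReal_re, Complex.mul_re,
      Complex.ofReal_im, Complex.I_re, Complex.I_im, mul_zero, mul_one, sub_zero, add_zero]
  · rw [im_diverg_apply, Complex.zero_im, ← hI]
    congr 1
    funext e
    simp only [gaugeShift, Matrix.sub_apply, Complex.sub_im, grad, one_smul, Matrix.of_apply, Complex.add_im, Complex.ofReal_im, Complex.mul_im,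
      Complex.ofReal_re, Complex.I_re, Complex.I_im, mul_zero, mul_one, zero_add, add_zero]

/-! ## §3 The pinned Hodge split of a matrix field: energy identity in Frobenius form and the entrywise Dirichlet principle -/

/-- Frobenius norm of a complex number as the two real squares. [folklore] -/
theorem normSq_eq_re_sq_add_im_sq (z : ℂ) : Complex.normSq z = z.re ^ 2 + z.im ^ 2 := by
  rw [Complex.normSq_apply]; ring

/-- **THE PINNED HODGE SPLIT OF A MATRIX FIELD** (`∂^*Y` supported on `C`): `∃ φ`, (i) `∂^*(Y − ∂φ) = 0`, (ii) `Δφ = ∂^*Y`, (iii) the Frobenius energy identity,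
(iv) the entrywise Dirichlet principle on `C` (real and imaginary parts). [cite: Balaban1985Variational, Prop. 7 p.299, (141)-(143) p.299] -/
theorem exists_matrixHodgeSplit_pinned (Y : PBond P j → Matrix (Fin N) (Fin N) ℂ) {C : Set (Site P j)}
    (hY : ∀ x : Site P j, x ∉ C → diverg 1 Y x = 0) :
    ∃ φ : Site P j → Matrix (Fin N) (Fin N) ℂ,
      diverg 1 (fun e : PBond P j => Y e - grad 1 φ e) = 0 ∧
      laplace 1 φ = diverg 1 Y ∧
      (∑ e : PBond P j, ∑ a : Fin N, ∑ b : Fin N, Complex.normSq ((Y e) a b)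
        = ∑ e : PBond P j, ∑ a : Fin N, ∑ b : Fin N, Complex.normSq ((Y e - grad 1 φ e) a b)
          + ∑ e : PBond P j, ∑ a : Fin N, ∑ b : Fin N, Complex.normSq ((grad 1 φ e) a b)) ∧
      (∀ (a b : Fin N) (ψ : SiteField P j ℝ), (∀ x ∈ C, ψ x = ((φ x) a b).re) →
        ∑ e : PBond P j, ((grad 1 φ e) a b).re ^ 2 ≤ ∑ e : PBond P j, grad 1 ψ e ^ 2) ∧
      (∀ (a b : Fin N) (ψ : SiteField P j ℝ), (∀ x ∈ C, ψ x = ((φ x) a b).im) →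
        ∑ e : PBond P j, ((grad 1 φ e) a b).im ^ 2 ≤ ∑ e : PBond P j, grad 1 ψ e ^ 2) := by
  obtain ⟨φ, hφ⟩ := exists_matrixCoulombGauge Y
  -- the component Coulomb conditions
  have hcompR : ∀ a b, diverg 1 (gaugeShift 1 (fun x => ((φ x) a b).re) (fun e : PBond P j => ((Y e) a b).re)) = 0 := by
    intro a b
    funext x
    have h := congrArg (fun M : Matrix (Fin N) (Fin N) ℂ => (M a b).re) (congrFun hφ x)
    simp only [Pi.zero_apply, Matrix.zero_apply, Complex.zero_re] at h
    rw [re_diverg_apply] at h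
    rw [Pi.zero_apply, ← h]
    congr 1
    funext e
    simp only [gaugeShift, Matrix.sub_apply, Complex.sub_re, re_grad_apply]
  have hcompI : ∀ a b, diverg 1 (gaugeShift 1 (fun x => ((φ x) a b).im) (fun e : PBond P j => ((Y e) a b).im)) = 0 := by
    intro a b
    funext x
    have h := congrArg (fun M : Matrix (Fin N) (Fin N) ℂ => (M a b).im) (congrFun hφ x)
    simp only [Pi.zero_apply, Matrix.zero_apply, Complex.zero_im] at h
    rw [im_diverg_apply] at h
    rw [Pi.zero_apply, ← h]
    congr 1
    funext e
    simp only [gaugeShift, Matrix.sub_apply, Complex.sub_im, im_grad_apply]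
  -- (ii) the Poisson equation, entrywise
  have hlap : laplace 1 φ = diverg 1 Y := by
    funext x
    ext a b
    have hR := congrFun (laplace_eq_diverg_of_hodge 1 (hcompR a b)) x
    have hI := congrFun (laplace_eq_diverg_of_hodge 1 (hcompI a b)) x
    apply Complex.ext
    · rw [re_laplace_apply, re_diverg_apply]; exact hR
    · rw [im_laplace_apply, im_diverg_apply]; exact hI
  -- the divergence of the components is supported on `C`
  have hsuppR : ∀ a b (x : Site P j), x ∉ C → diverg 1 (fun e : PBond P j => ((Y e) a b).re) x = 0 := fun a b x hx => by
    rw [← re_diverg_apply, hY x hx]; simp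
  have hsuppI : ∀ a b (x : Site P j), x ∉ C → diverg 1 (fun e : PBond P j => ((Y e) a b).im) x = 0 := fun a b x hx => by
    rw [← im_diverg_apply, hY x hx]; simp
  refine ⟨φ, hφ, hlap, ?_, ?_, ?_⟩
  · -- (iii) Frobenius energy identity: regroup the real identities of the components
    have hcrossR : ∀ a b, ∑ e : PBond P j, grad 1 (fun x => ((φ x) a b).re) e * (((Y e) a b).re - grad 1 (fun x => ((φ x) a b).re) e) = 0 :=
      fun a b => sum_grad_mul_eq_zero_of_diverg_eq_zero 1 _ (hcompR a b)
    have hcrossI : ∀ a b, ∑ e : PBond P j, grad 1 (fun x => ((φ x) a b).im) e * (((Y e) a b).im - grad 1 (fun x => ((φ x) a b).im) e) = 0 :=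
      fun a b => sum_grad_mul_eq_zero_of_diverg_eq_zero 1 _ (hcompI a b)
    rw [← Finset.sum_add_distrib]
    refine Finset.sum_comm.trans ?_
    rw [show (∑ e : PBond P j, (∑ a : Fin N, ∑ b : Fin N, Complex.normSq ((Y e - grad 1 φ e) a b)
        + ∑ a : Fin N, ∑ b : Fin N, Complex.normSq ((grad 1 φ e) a b)))
        = ∑ a : Fin N, ∑ e : PBond P j, (∑ b : Fin N, Complex.normSq ((Y e - grad 1 φ e) a b) + ∑ b : Fin N, Complex.normSq ((grad 1 φ e) a b)) by
      rw [Finset.sum_comm]; exact Finset.sum_congr rfl fun e _ => (Finset.sum_add_distrib).symm]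
    refine Finset.sum_congr rfl fun a _ => ?_
    rw [Finset.sum_comm]
    rw [show (∑ e : PBond P j, (∑ b : Fin N, Complex.normSq ((Y e - grad 1 φ e) a b) + ∑ b : Fin N, Complex.normSq ((grad 1 φ e) a b)))
        = ∑ b : Fin N, ∑ e : PBond P j, (Complex.normSq ((Y e - grad 1 φ e) a b) + Complex.normSq ((grad 1 φ e) a b)) by
      rw [Finset.sum_comm]; exact Finset.sum_congr rfl fun e _ => (Finset.sum_add_distrib).symm]
    refine Finset.sum_congr rfl fun b _ => ?_
    -- one entry: two real energy identities
    have hR := hcrossR a b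
    have hI := hcrossI a b
    simp only [normSq_eq_re_sq_add_im_sq, Matrix.sub_apply, Complex.sub_re, Complex.sub_im, re_grad_apply, im_grad_apply]
    rw [← sub_eq_zero]
    have : ∑ e : PBond P j, ((((Y e) a b).re) ^ 2 + (((Y e) a b).im) ^ 2)
        - ∑ e : PBond P j, (((((Y e) a b).re - grad 1 (fun x => ((φ x) a b).re) e) ^ 2
              + ((((Y e) a b).im - grad 1 (fun x => ((φ x) a b).im) e)) ^ 2)
            + ((grad 1 (fun x => ((φ x) a b).re) e) ^ 2 + (grad 1 (fun x => ((φ x) a b).im) e) ^ 2))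
        = 2 * ∑ e : PBond P j, grad 1 (fun x => ((φ x) a b).re) e * (((Y e) a b).re - grad 1 (fun x => ((φ x) a b).re) e)
          + 2 * ∑ e : PBond P j, grad 1 (fun x => ((φ x) a b).im) e * (((Y e) a b).im - grad 1 (fun x => ((φ x) a b).im) e) := by
      rw [Finset.mul_sum, Finset.mul_sum, ← Finset.sum_add_distrib, ← Finset.sum_sub_distrib]
      exact Finset.sum_congr rfl fun e _ => by ring
    rw [this, hR, hI]
    ring
  · -- (iv) real parts
    intro a b ψ hψ
    have h := Summit.QuantumFields.YangMills.Theorems.Prop7PinnedHodgeSplit.sum_grad_sq_hodge_le 1 (hsuppR a b) (hcompR a b) ψ hψ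
    simpa only [re_grad_apply] using h
  · -- (iv) imaginary parts
    intro a b ψ hψ
    have h := Summit.QuantumFields.YangMills.Theorems.Prop7PinnedHodgeSplit.sum_grad_sq_hodge_le 1 (hsuppI a b) (hcompI a b) ψ hψ
    simpa only [im_grad_apply] using h

end Summit.QuantumFields.YangMills.Theorems.Prop7MatrixHodgeSplit

end
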